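import Mathlib
import Literature.Geometry.Symplectic.JHolomorphicLimitEmbeddedProofs
import Literature.Geometry.Symplectic.JHolomorphicIsolatedIntersectionPersists
import Literature.Geometry.Symplectic.JHolomorphicMap
import Summits.SmoothPoincare4.SmoothPoincare4.Theorems.SullivanDualTameOrBrodyR4PencilDefs
import Summits.SmoothPoincare4.SmoothPoincare4.Theorems.SullivanDualTameOrBrodyR4HelperFarCrossings

/-!
# Limits of pencil members are immersed, modulo McDuff's no-cusp fact (stub `helper_immersedLimitsOfNoCusp`, Sketch)

Crux `stmt-SmoothPoincare4-7826` (`TameOrBrodyR4`), line `Sketch`, in the vocabulary of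
`Theorems/SullivanDualTameOrBrodyR4PencilDefs.lean` (CORE-B modulo McDuff). ASSUMING the named
fact `Literature.Geometry.Symplectic.jHolomorphic_immersed_of_limitEmbedded_punctured` (McDuff 1991,
Thm 1.4 / Cor. 4.4: no cusps in limits of embedded `J`-curves), a `C¹_loc`-limit `v` of pencil
members `u n` which is `C^∞`, flat-`J`-holomorphic and has the member asymptotics and far structure
(`P (v ξ) - ξ → 0`, every far line `{P = c}`, `|c| > 2R`, crossed exactly once, transversally) is
immersed everywhere.

Proof: Literature's reduction
`jHolomorphicLimitOfEmbedded_isEmbedded_of_persist_of_noCusp jHolomorphic_isolatedIntersection_persists_holds hCusp`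
(McDuff's limit theorem for embedded `J`-planes from positivity of intersections — a theorem of the
tree — and the assumed no-cusp fact) is instantiated on the model space `V := ℝ⁴` (charted by
itself, `ι := id`), where `ContMDiff ↔ ContDiff`, `mfderiv = fderiv`, `IsJHolomorphic ↔
IsJHolomorphicFlat` and `inTangentCoordinates … J = J`. The collar hypotheses come from the far
structure of `v`: with `L` a tail radius (`‖P (v ξ) - ξ‖ < 1` for `‖ξ‖ ≥ L`) and
`r₀ := max L (2R + 1)`, every `ξ` with `‖ξ‖ > r₀` has `|P (v ξ)| > 2R`, so on `‖ξ‖ > r₀` the map `v`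
is injective (far values of `P ∘ v` are taken once), immersed (`d(P ∘ v) = P ∘ dv` is bijective)
and takes no value of `v` on `‖ξ‖ ≤ r₀` (again by uniqueness of far crossings); given `ξ₀`, take
`r₁ := max (r₀ + 1) (‖ξ₀‖ + 1)`.
-/

-- the registered namespace `Summit.SmoothPoincare4.SmoothPoincare4.…` repeats a component
set_option linter.dupNamespace false

noncomputable section

open scoped ContDiff Topology NNReal Manifold
open Filter Set Metric Literature.Geometry.Symplectic

namespace Summit.SmoothPoincare4.SmoothPoincare4.Cruxes.TameOrBrodyR4.Sketch

/-- Local notation for the model space `ℝ⁴ = EuclideanSpace ℝ (Fin 4)`. -/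
local notation "E4" => EuclideanSpace ℝ (Fin 4)

namespace ImmersedLimitsOfNoCusp

/-- On the model space `ℝ⁴` a `C^∞` field of endomorphisms `J` is `C^∞` in tangent coordinates
(`inTangentCoordinates … J = J` on a vector space charted by itself). -/
theorem contMDiffAt_inTangentCoordinates_model {J : E4 → E4 →L[ℝ] E4} (hJs : ContDiff ℝ ∞ J)
    (x₀ : E4) :
    ContMDiffAt (𝓡 4) 𝓘(ℝ, E4 →L[ℝ] E4) ∞
      (inTangentCoordinates (𝓡 4) (𝓡 4) (id : E4 → E4) id (fun x => J x) x₀) x₀ := by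
  rw [inTangentCoordinates_model_space]
  exact contMDiffAt_iff_contDiffAt.2 hJs.contDiffAt

/-- The identity of the model space `ℝ⁴` has injective manifold derivative. -/
theorem mfderiv_id_injective (x : E4) :
    Function.Injective (mfderiv (𝓡 4) 𝓘(ℝ, E4) (id : E4 → E4) x) := by
  rw [mfderiv_id]
  exact Function.injective_id

/-- **Far points have far `P`-values.** If `‖P (v ξ) - ξ‖ < 1` for `‖ξ‖ ≥ L`, then
`2R < |P (v ξ)|` whenever `max L (2R + 1) < ‖ξ‖`. -/
theorem far_value {v : ℂ → E4} {P : E4 →L[ℝ] ℂ} {L R : ℝ}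
    (hL : ∀ ξ : ℂ, L ≤ ‖ξ‖ → ‖P (v ξ) - ξ‖ < 1) {ξ : ℂ} (hξ : max L (2 * R + 1) < ‖ξ‖) :
    2 * R < ‖P (v ξ)‖ := by
  have h1 : ‖P (v ξ) - ξ‖ < 1 := hL ξ ((le_max_left _ _).trans hξ.le)
  have h2 : 2 * R + 1 < ‖ξ‖ := (le_max_right _ _).trans_lt hξ
  have h3 : ‖ξ‖ - ‖P (v ξ)‖ ≤ ‖P (v ξ) - ξ‖ := by
    rw [← norm_neg (P (v ξ) - ξ), neg_sub]; exact norm_sub_norm_le ξ (P (v ξ))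
  linarith

/-- **Immersed where `P ∘ v` is a local diffeomorphism.** If `v` is differentiable at `ξ` and
`d(P ∘ v)(ξ) = P ∘ dv(ξ)` is bijective, then `dv(ξ)` is injective. -/
theorem fderiv_injective_of_bijective {v : ℂ → E4} {P : E4 →L[ℝ] ℂ} {ξ : ℂ}
    (hv : DifferentiableAt ℝ v ξ)
    (hb : Function.Bijective (fderiv ℝ (fun ξ => P (v ξ)) ξ)) :
    Function.Injective (fderiv ℝ v ξ) := by
  have hd : fderiv ℝ (fun ξ => P (v ξ)) ξ = P.comp (fderiv ℝ v ξ) :=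
    (P.hasFDerivAt.comp ξ hv.hasFDerivAt).fderiv
  have hinj := hb.1
  rw [hd, ContinuousLinearMap.coe_comp] at hinj
  exact hinj.of_comp

end ImmersedLimitsOfNoCusp

open ImmersedLimitsOfNoCusp in
/-- **Registered stub `helper_immersedLimitsOfNoCusp` (CORE-B modulo McDuff's no-cusp fact).**
ASSUMING `jHolomorphic_immersed_of_limitEmbedded_punctured` (McDuff 1991 Thm 1.4 / Cor. 4.4), a
`C¹_loc`-limit `v` of pencil members `u n` (asymptotic values `b n → bs`) which is `C^∞`,
flat-`J`-holomorphic and has the member asymptotics and far structure is immersed everywhere.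
Proof: McDuff's limit theorem for embedded `J`-planes
(`jHolomorphicLimitOfEmbedded_isEmbedded_of_persist_of_noCusp` with the tree's positivity of
intersections `jHolomorphic_isolatedIntersection_persists_holds` and the assumed no-cusp fact) on
the model space `ℝ⁴` with `ι = id`; the collar `max L (2R + 1) < ‖ξ‖ < r₁` (with `L` a tail radius
of `P ∘ v` and `r₁ > ‖ξ₀‖`) is embedded and separated from the inner disc by the far structure. -/
theorem helper_immersedLimitsOfNoCusp
    (hCusp : Literature.Geometry.Symplectic.jHolomorphic_immersed_of_limitEmbedded_punctured)
    (J : E4 → E4 →L[ℝ] E4) (R : ℝ) (P Q : E4 →L[ℝ] ℂ) (eP eQ : ℂ →L[ℝ] E4)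
    (hR : 0 < R) (hJs : ContDiff ℝ ∞ J) (hJ2 : ∀ x v, J x (J x v) = -v)
    (hPQ : IsCoordFrame P Q eP eQ)
    (hJP : ∀ x : E4, R ≤ ‖x‖ → ∀ v, P (J x v) = Complex.I * P v)
    (hJQ : ∀ x : E4, R ≤ ‖x‖ → ∀ v, Q (J x v) = Complex.I * Q v) :
    ∀ (b : ℕ → ℂ) (u : ℕ → ℂ → E4) (bs : ℂ) (v : ℂ → E4),
      (∀ n, IsPencilMember J R P Q (b n) (u n)) → Tendsto b atTop (𝓝 bs) →
      ContDiff ℝ ∞ v → IsJHolomorphicFlat J v →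
      TendstoLocallyUniformly u v atTop →
      TendstoLocallyUniformly (fun n => fderiv ℝ (u n)) (fderiv ℝ v) atTop →
      Tendsto (fun ξ => Q (v ξ)) (cocompact ℂ) (𝓝 bs) →
      Tendsto (fun ξ => P (v ξ) - ξ) (cocompact ℂ) (𝓝 0) →
      (∀ c : ℂ, 2 * R < ‖c‖ → ∃! ξ, P (v ξ) = c) →
      (∀ ξ : ℂ, 2 * R < ‖P (v ξ)‖ → Function.Bijective (fderiv ℝ (fun ξ => P (v ξ)) ξ)) →
      ∀ ξ : ℂ, Function.Injective (fderiv ℝ v ξ) := by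
  intro _b u _bs v hu _hb hv hvJ hconv _hconv' _hQ hP hfar hbij ξ₀
  have _ := hPQ
  have _ := hJP
  have _ := hJQ
  -- the Literature reduction of McDuff's limit theorem (positivity of intersections is proved)
  have hMain : jHolomorphicLimitOfEmbedded_isEmbedded :=
    jHolomorphicLimitOfEmbedded_isEmbedded_of_persist_of_noCusp
      jHolomorphic_isolatedIntersection_persists_holds hCusp
  -- data of the members and of the limit, in manifold language on the model space
  have hus : ∀ n, ContMDiff 𝓘(ℝ, ℂ) (𝓡 4) ∞ (u n) := fun n => contMDiff_iff_contDiff.2 (hu n).1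
  have huJ : ∀ n, IsJHolomorphic (𝓡 4) J (u n) := fun n =>
    isJHolomorphic_modelSpace_iff.2 (hu n).2.1
  have huinj : ∀ n, Function.Injective (u n) := fun n => (hu n).2.2.1
  have huimm : ∀ n (ξ : ℂ), Function.Injective (mfderiv 𝓘(ℝ, ℂ) (𝓡 4) (u n) ξ) := by
    intro n ξ
    rw [mfderiv_eq_fderiv]
    exact (hu n).2.2.2.1 ξ
  have hvs : ContMDiff 𝓘(ℝ, ℂ) (𝓡 4) ∞ v := contMDiff_iff_contDiff.2 hv
  have hvJ' : IsJHolomorphic (𝓡 4) J v := isJHolomorphic_modelSpace_iff.2 hvJ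
  have hconvK : ∀ D : Set ℂ, IsCompact D →
      TendstoUniformlyOn (fun n ζ => id (u n ζ)) (fun ζ => id (v ζ)) atTop D := fun D hD =>
    (tendstoLocallyUniformly_iff_forall_isCompact.1 hconv) D hD
  -- radii
  obtain ⟨L, hL⟩ := FarCrossings.exists_tail_radius hP
  set r₀ : ℝ := max L (2 * R + 1) with hr₀def
  set r₁ : ℝ := max (r₀ + 1) (‖ξ₀‖ + 1) with hr₁def
  have hr₀ : 0 < r₀ := lt_max_of_lt_right (by linarith)
  have hr₁ : r₀ < r₁ := lt_max_of_lt_left (lt_add_one r₀)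
  have hfarP : ∀ ξ : ℂ, r₀ < ‖ξ‖ → 2 * R < ‖P (v ξ)‖ := fun ξ hξ => far_value hL hξ
  have hvd : Differentiable ℝ v := hv.differentiable (by simp)
  -- the collar is embedded and separated from the inner disc
  have hinjA : Set.InjOn v {ξ : ℂ | r₀ < ‖ξ‖ ∧ ‖ξ‖ < r₁} := by
    intro a ha c _ hac
    exact (hfar (P (v a)) (hfarP a ha.1)).unique rfl (congrArg P hac).symm
  have himmA : ∀ ξ : ℂ, r₀ < ‖ξ‖ → ‖ξ‖ < r₁ →
      Function.Injective (mfderiv 𝓘(ℝ, ℂ) (𝓡 4) v ξ) := by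
    intro ξ hξ _
    rw [mfderiv_eq_fderiv]
    exact fderiv_injective_of_bijective (hvd ξ) (hbij ξ (hfarP ξ hξ))
  have hsep : ∀ ξ ξ' : ℂ, ‖ξ‖ ≤ r₀ → r₀ < ‖ξ'‖ → ‖ξ'‖ < r₁ → v ξ ≠ v ξ' := by
    intro ξ ξ' hξ hξ' _ heq
    have h : ξ = ξ' := (hfar (P (v ξ')) (hfarP ξ' hξ')).unique (congrArg P heq) rfl
    rw [h] at hξ
    exact absurd hξ' (not_lt.2 hξ)
  -- McDuff's theorem on the disc `‖ξ‖ < r₁`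
  obtain ⟨-, himm⟩ := hMain E4 (fun x => J x) (fun x w => hJ2 x w)
    (contMDiffAt_inTangentCoordinates_model hJs) 4 id Topology.IsEmbedding.id contMDiff_id
    mfderiv_id_injective u v r₀ r₁ hr₀ hr₁ hus huJ huinj huimm hvs hvJ' hconvK hinjA himmA hsep
  have hξ₀ : ξ₀ ∈ ball (0 : ℂ) r₁ := by
    rw [mem_ball_zero_iff]
    exact (lt_add_one _).trans_le (le_max_right _ _)
  have h := himm ξ₀ hξ₀
  rwa [mfderiv_eq_fderiv] at h

end Summit.SmoothPoincare4.SmoothPoincare4.Cruxes.TameOrBrodyR4.Sketch
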